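import Literature.Analysis.OperatorTheory.KernelPathIntegralPeeling
import HarnessLib

/-!
# Peeling path integrals of a transfer kernel around a cycle (periodic boundary conditions)

Topic `Literature/Analysis/OperatorTheory`; companion of `KernelPathIntegralPeeling.lean` (open
blocks with a left boundary spin: `integral_pathWeight_succ_eq`, `integral_pathWeight_eq_iterate`).
Here the block is CLOSED into a cycle of `N = k + 1 + n' + 1` sites `V : Fin N → Y` with the
periodic weight `∏_{t : Fin N} K(V t, V (t+1))` (`Fin` addition, so the last factor is
`K(V (N-1), V 0)`), and two one-site observables are inserted, `F` at site `0` and `G` at site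
`n' + 1`. Everything is PROVED, Mathlib + the companion file only, no definitions (the pointwise
transfer operator `(κ f)(y) = ∫ K(y, z) f(z) dρ(z)` is written out):

* `integral_pi_succ_eq_integral_cons` — `∫ Φ dρ^{⊗(M+1)} = ∫ (∫ Φ(y ∷ ζ') dρ^{⊗M}(ζ')) dρ(y)` for
  bounded measurable `Φ` (Fubini along `Fin.cons`);
* `prod_cyclic_cons` — cutting the cycle at site `0`: for `V = x ∷ ζ` the periodic weight is the
  open path weight `∏ᵢ K((x ∷ ζ)ᵢ, ζᵢ)` times the closing factor `K(ζ_last, x)`;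
* `integral_pathWeight_mul_kernel_last_eq_iterate` — `∫ (∏ᵢ K((y∷η)ᵢ, ηᵢ)) K((y∷η)_last, x) dρ^{⊗k}(η)
  = (κ^[k] K(·, x))(y)` (the iterated kernel `K^{(k+1)}(y, x)`);
* `integral_cyclic_eq_integral_iterate` (**main**) — the TRACE FORMULA
  `∫ F(V 0) G(V p) ∏_t K(V t, V (t+1)) dρ^{⊗N}(V) = ∫ F(x) (κ^[n'+1] (G · κ^[k] K(·, x)))(x) dρ(x)`
  for `p = n' + 1`: the two arcs of the cycle between the insertions, of `n' + 1` and `k + 1`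
  bonds, become the kernel iterates `K^{(n'+1)}` and `K^{(k+1)}` ("`Tr (F 𝕋^{n'+1} G 𝕋^{k+1})`"
  written without operator traces).

This is the path-space side of the transfer-operator treatment of one-dimensional (or time-sliced)
models with PERIODIC boundary conditions; the spectral side is `CyclicKernelClustering.lean`.
[folklore]
-/

noncomputable section

open MeasureTheory Filter Set Function

namespace Literature.Analysis.OperatorTheory

variable {Y : Type*} [MeasurableSpace Y] {ρ : Measure Y} [IsFiniteMeasure ρ]
  {K : Y → Y → ℝ} {C : ℝ}

/-- **Fubini along `Fin.cons`**: for a bounded measurable `Φ` on a block of `M + 1` sites,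
`∫ Φ dρ^{⊗(M+1)} = ∫ (∫ Φ(y ∷ ζ') dρ^{⊗M}(ζ')) dρ(y)` (Mathlib `measurePreserving_piFinSuccAbove`
at the pivot `0`). [folklore] -/
theorem integral_pi_succ_eq_integral_cons (M : ℕ) {Φ : (Fin (M + 1) → Y) → ℝ} (hΦ : Measurable Φ)
    {B : ℝ} (hΦb : ∀ ζ, ‖Φ ζ‖ ≤ B) :
    ∫ ζ, Φ ζ ∂(Measure.pi fun _ : Fin (M + 1) => ρ) =
      ∫ y, ∫ ζ' : Fin M → Y, Φ (Fin.cons y ζ') ∂(Measure.pi fun _ => ρ) ∂ρ := by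
  set pi : Measure (Fin M → Y) := Measure.pi fun _ => ρ with hpi
  have hmp := (measurePreserving_piFinSuccAbove (fun _ : Fin (M + 1) => ρ) 0).symm
  have he : ∀ p : Y × (Fin M → Y),
      (MeasurableEquiv.piFinSuccAbove (fun _ : Fin (M + 1) => Y) 0).symm p = Fin.cons p.1 p.2 := by
    intro p
    simp only [MeasurableEquiv.piFinSuccAbove_symm_apply, Fin.insertNthEquiv, Fin.insertNth_zero,
      Equiv.coe_fn_mk]
    rfl
  have h1 : ∫ ζ, Φ ζ ∂(Measure.pi fun _ : Fin (M + 1) => ρ) =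
      ∫ p, Φ (Fin.cons p.1 p.2) ∂(ρ.prod pi) := by
    rw [← hmp.integral_comp']
    refine integral_congr_ae (Eventually.of_forall fun p => ?_)
    dsimp only
    rw [he]
  rw [h1]
  have hcm : Measurable fun p : Y × (Fin M → Y) => (Fin.cons p.1 p.2 : Fin (M + 1) → Y) :=
    measurable_finCons M
  have hint : Integrable (fun p : Y × (Fin M → Y) => Φ (Fin.cons p.1 p.2)) (ρ.prod pi) :=
    memLp_one_iff_integrable.1
      (MemLp.of_bound (hΦ.comp hcm).aestronglyMeasurable B (Eventually.of_forall fun p => hΦb _))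
  rw [integral_prod _ hint]

omit [MeasurableSpace Y] in
/-- **Cutting the cycle at site `0`.** For `V = x ∷ ζ` on the cycle of `k + 1 + n' + 1` sites, the
periodic weight `∏_t K(V t, V (t + 1))` is the open path weight `∏ᵢ K((x ∷ ζ)ᵢ, ζᵢ)` times the
closing bond `K(ζ_{k+n'}, x)` (the last site is written `(Fin.last k).addNat n'`). [folklore] -/
theorem prod_cyclic_cons (K : Y → Y → ℝ) (k n' : ℕ) (x : Y) (ζ : Fin (k + 1 + n') → Y) :
    ∏ t : Fin (k + 1 + n' + 1), K ((Fin.cons x ζ : Fin (k + 1 + n' + 1) → Y) t)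
        ((Fin.cons x ζ : Fin (k + 1 + n' + 1) → Y) (t + 1)) =
      (∏ i : Fin (k + 1 + n'), K ((Fin.cons x ζ : Fin (k + 1 + n' + 1) → Y) (Fin.castSucc i)) (ζ i)) *
        K (ζ ((Fin.last k).addNat n')) x := by
  rw [Fin.prod_univ_castSucc]
  have hlast : (Fin.last (k + 1 + n') : Fin (k + 1 + n' + 1)) = ((Fin.last k).addNat n').succ :=
    Fin.ext (by simp; omega)
  congr 1
  · refine Finset.prod_congr rfl fun i _ => ?_
    rw [Fin.coeSucc_eq_succ, Fin.cons_succ]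
  · rw [Fin.last_add_one, Fin.cons_zero, hlast, Fin.cons_succ]

/-- **The closing arc is an iterated kernel**: for every `x, y`,
`∫ (∏ᵢ K((y ∷ η)ᵢ, ηᵢ)) K((y ∷ η)_{last}, x) dρ^{⊗k}(η) = (κ^[k] K(·, x))(y)` — the `k + 1` bonds
from `y` through the `k` integrated sites to `x` give the iterated kernel `K^{(k+1)}(y, x)`.
[folklore] -/
theorem integral_pathWeight_mul_kernel_last_eq_iterate (hK : Measurable (uncurry K))
    (hC : ∀ x y, ‖K x y‖ ≤ C) (x : Y) (k : ℕ) (y : Y) :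
    ∫ η : Fin k → Y, (∏ i : Fin k, K ((Fin.cons y η : Fin (k + 1) → Y) (Fin.castSucc i)) (η i)) *
        K ((Fin.cons y η : Fin (k + 1) → Y) (Fin.last k)) x ∂(Measure.pi fun _ => ρ) =
      (fun f : Y → ℝ => fun w => ∫ z, K w z * f z ∂ρ)^[k] (fun z => K z x) y := by
  induction k generalizing y with
  | zero =>
    simp only [Finset.univ_eq_empty, Finset.prod_empty, one_mul, Fin.last_zero, Fin.cons_zero,
      Function.iterate_zero, id_eq]
    rw [integral_const, smul_eq_mul]
    have : (Measure.pi fun _ : Fin 0 => ρ).real univ = 1 := by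
      rw [measureReal_def, Measure.pi_univ]
      simp
    rw [this, one_mul]
  | succ k ih =>
    have hKx : Measurable fun z => K z x := hK.comp (measurable_id.prodMk measurable_const)
    have hFm : Measurable fun η : Fin (k + 1) → Y => K (η (Fin.last k)) x :=
      hKx.comp (measurable_pi_apply _)
    have h1 := integral_pathWeight_succ_eq (ρ := ρ) hK hC k y
      (F := fun η : Fin (k + 1) → Y => K (η (Fin.last k)) x) hFm (fun η => hC _ _)
    have hlast : ∀ η : Fin (k + 1) → Y,
        (Fin.cons y η : Fin (k + 1 + 1) → Y) (Fin.last (k + 1)) = η (Fin.last k) := fun η => by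
      rw [← Fin.succ_last, Fin.cons_succ]
    simp_rw [hlast]
    rw [h1, Function.iterate_succ_apply']
    refine integral_congr_ae (Eventually.of_forall fun w => ?_)
    dsimp only
    rw [← ih w]

/-- **The block after the first arc.** With the observable `G` at the first site of a block of
`k + 1` sites with boundary spin `z` and the closing bond `K(·_last, x)` at its last site,
`∫ (∏ᵢ K((z∷η)ᵢ, ηᵢ)) G(η₀) K(η_last, x) dρ^{⊗(k+1)}(η) = ∫ K(z, y) G(y) (κ^[k] K(·, x))(y) dρ(y)`
(one-step peeling, then `integral_pathWeight_mul_kernel_last_eq_iterate`). [folklore] -/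
theorem integral_pathWeight_obs_mul_kernel_last_eq (hK : Measurable (uncurry K))
    (hC : ∀ x y, ‖K x y‖ ≤ C) (k : ℕ) {G : Y → ℝ} (hG : Measurable G) {BG : ℝ}
    (hGb : ∀ y, ‖G y‖ ≤ BG) (x : Y) :
    (fun z => ∫ η : Fin (k + 1) → Y, (∏ i : Fin (k + 1),
        K ((Fin.cons z η : Fin (k + 1 + 1) → Y) (Fin.castSucc i)) (η i)) *
          (G (η 0) * K (η (Fin.last k)) x) ∂(Measure.pi fun _ => ρ)) =
      fun w => ∫ y, K w y * (G y *
        (fun f : Y → ℝ => fun w => ∫ z, K w z * f z ∂ρ)^[k] (fun z => K z x) y) ∂ρ := by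
  have hKx : Measurable fun z => K z x := hK.comp (measurable_id.prodMk measurable_const)
  have hObsm : Measurable fun η : Fin (k + 1) → Y => G (η 0) * K (η (Fin.last k)) x :=
    (hG.comp (measurable_pi_apply 0)).mul (hKx.comp (measurable_pi_apply _))
  have hObsb : ∀ η : Fin (k + 1) → Y, ‖G (η 0) * K (η (Fin.last k)) x‖ ≤ BG * C := fun η => by
    rw [norm_mul]
    exact mul_le_mul (hGb _) (hC _ _) (norm_nonneg _) ((norm_nonneg _).trans (hGb (η 0)))
  funext z
  rw [integral_pathWeight_succ_eq (ρ := ρ) hK hC k z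
    (F := fun η : Fin (k + 1) → Y => G (η 0) * K (η (Fin.last k)) x) hObsm hObsb]
  refine integral_congr_ae (Eventually.of_forall fun y => ?_)
  dsimp only
  simp only [Fin.cons_zero]
  congr 1
  rw [← integral_pathWeight_mul_kernel_last_eq_iterate (ρ := ρ) hK hC x k y, ← integral_const_mul]
  refine integral_congr_ae (Eventually.of_forall fun η' => ?_)
  dsimp only
  ring

/-- **Trace formula for the cycle (periodic boundary conditions).** Let `K` be a bounded
measurable kernel on a finite measure space `(Y, ρ)`, `κ f = ∫ K(·, z) f(z) dρ(z)`, and `F`, `G`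
bounded measurable one-site observables. On the cycle of `N = k + 1 + n' + 1` sites with the
periodic weight `∏_{t : Fin N} K(V t, V (t+1))`, inserting `F` at site `0` and `G` at the site `p`
with `p = n' + 1`,
`∫ F(V 0) G(V p) ∏_t K(V t, V (t+1)) dρ^{⊗N}(V) = ∫ F(x) · (κ^[n'+1] (y ↦ G(y) · (κ^[k] K(·, x))(y)))(x) dρ(x)`:
the arc `0 → p` of `n' + 1` bonds and the arc `p → 0` of `k + 1` bonds become the kernel iterates
`K^{(n'+1)}`, `K^{(k+1)}` (the path-space form of `Tr(F 𝕋^{n'+1} G 𝕋^{k+1})`). [folklore] -/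
theorem integral_cyclic_eq_integral_iterate (hK : Measurable (uncurry K)) (hC : ∀ x y, ‖K x y‖ ≤ C)
    (k n' : ℕ) {F G : Y → ℝ} (hF : Measurable F) (hG : Measurable G) {BF BG : ℝ}
    (hFb : ∀ y, ‖F y‖ ≤ BF) (hGb : ∀ y, ‖G y‖ ≤ BG) (p : Fin (k + 1 + n' + 1))
    (hp : (p : ℕ) = n' + 1) :
    ∫ V : Fin (k + 1 + n' + 1) → Y, F (V 0) * G (V p) * ∏ t, K (V t) (V (t + 1))
        ∂(Measure.pi fun _ => ρ) =
      ∫ x, F x * (fun f : Y → ℝ => fun w => ∫ z, K w z * f z ∂ρ)^[n' + 1]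
        (fun y => G y * (fun f : Y → ℝ => fun w => ∫ z, K w z * f z ∂ρ)^[k] (fun z => K z x) y) x
        ∂ρ := by
  -- the insertion site `p` is the successor of the open-path site `(0 : Fin (k+1)).addNat n'`
  have hpG : p = ((0 : Fin (k + 1)).addNat n').succ := Fin.ext (by simp [hp])
  -- Step 1: cut the cycle at site `0` (Fubini along `Fin.cons`)
  have hΦm : Measurable fun V : Fin (k + 1 + n' + 1) → Y =>
      F (V 0) * G (V p) * ∏ t, K (V t) (V (t + 1)) := by
    refine ((hF.comp (measurable_pi_apply 0)).mul (hG.comp (measurable_pi_apply p))).mul ?_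
    refine Finset.measurable_prod _ fun t _ => ?_
    have h := hK.comp ((measurable_pi_apply (X := fun _ : Fin (k + 1 + n' + 1) => Y) t).prodMk
      (measurable_pi_apply (X := fun _ : Fin (k + 1 + n' + 1) => Y) (t + 1)))
    exact h
  have hΦb : ∀ V : Fin (k + 1 + n' + 1) → Y,
      ‖F (V 0) * G (V p) * ∏ t, K (V t) (V (t + 1))‖ ≤ BF * BG * C ^ (k + 1 + n' + 1) := by
    intro V
    have hBF : 0 ≤ BF := (norm_nonneg _).trans (hFb (V 0))
    have hBG : 0 ≤ BG := (norm_nonneg _).trans (hGb (V p))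
    have hP : ‖∏ t, K (V t) (V (t + 1))‖ ≤ C ^ (k + 1 + n' + 1) := by
      calc ‖∏ t, K (V t) (V (t + 1))‖ ≤ ∏ t, ‖K (V t) (V (t + 1))‖ := Finset.norm_prod_le _ _
        _ ≤ ∏ _t : Fin (k + 1 + n' + 1), C :=
            Finset.prod_le_prod (fun t _ => norm_nonneg _) fun t _ => hC _ _
        _ = C ^ (k + 1 + n' + 1) := by simp
    rw [norm_mul, norm_mul]
    exact mul_le_mul (mul_le_mul (hFb _) (hGb _) (norm_nonneg _) hBF) hP (norm_nonneg _)
      (mul_nonneg hBF hBG)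
  rw [integral_pi_succ_eq_integral_cons (ρ := ρ) (k + 1 + n') hΦm hΦb]
  refine integral_congr_ae (Eventually.of_forall fun x => ?_)
  dsimp only
  -- Step 2: the integrand on the open path `ζ` with boundary spin `x`
  have hKx : Measurable fun z => K z x := hK.comp (measurable_id.prodMk measurable_const)
  have hObsm : Measurable fun η : Fin (k + 1) → Y => G (η 0) * K (η (Fin.last k)) x :=
    (hG.comp (measurable_pi_apply 0)).mul (hKx.comp (measurable_pi_apply _))
  have hObsb : ∀ η : Fin (k + 1) → Y, ‖G (η 0) * K (η (Fin.last k)) x‖ ≤ BG * C := fun η => by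
    rw [norm_mul]
    exact mul_le_mul (hGb _) (hC _ _) (norm_nonneg _) ((norm_nonneg _).trans (hGb (η 0)))
  have hcut : ∀ ζ : Fin (k + 1 + n') → Y,
      F ((Fin.cons x ζ : Fin (k + 1 + n' + 1) → Y) 0) *
          G ((Fin.cons x ζ : Fin (k + 1 + n' + 1) → Y) p) *
          ∏ t, K ((Fin.cons x ζ : Fin (k + 1 + n' + 1) → Y) t)
            ((Fin.cons x ζ : Fin (k + 1 + n' + 1) → Y) (t + 1)) =
        F x * ((∏ i : Fin (k + 1 + n'),
          K ((Fin.cons x ζ : Fin (k + 1 + n' + 1) → Y) (Fin.castSucc i)) (ζ i)) *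
          (fun η : Fin (k + 1) → Y => G (η 0) * K (η (Fin.last k)) x) fun i => ζ (i.addNat n')) := by
    intro ζ
    rw [prod_cyclic_cons K k n' x ζ, Fin.cons_zero, hpG, Fin.cons_succ]
    ring
  simp_rw [hcut]
  rw [integral_const_mul]
  congr 1
  -- Step 3: peel the `n'` sites of the first arc; Step 4: the remaining block of `k + 1` sites
  rw [integral_pathWeight_eq_iterate (ρ := ρ) hK hC (k + 1) hObsm hObsb n' x,
    Function.iterate_succ_apply]
  beta_reduce
  rw [integral_pathWeight_obs_mul_kernel_last_eq (ρ := ρ) hK hC k hG hGb x]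

end Literature.Analysis.OperatorTheory

end
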